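import Summits.MatrixMultiplication.MatrixMultiplication.Theorems.OutsiderSandwichTwistGluing
import HarnessLib

/-!
# The twist gluing, II: the matrix slices of `C₁^{⊠N}` and of `⟨2,2,2⟩^{⊠N}`

Route `OutsiderSandwich` (decomposition cell `decomp-mm`, lens 4 «minimal counterexample /
extremal reduction», gen 26), support for the aside leaf `BlockOneIsMM`
(stmt-MatrixMultiplication-27147, `⟺ θ⋆ = 0`); the cut of record is untouched.  Companion of
`OutsiderSandwichTwistGluing` (partial transposes `τ_c = ptrans c`, no-untwisting lemma).

## Content: one matrix in ALL orientations versus one matrix in ONE orientation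

Both `C₁ ≅ pairTensor 2` (the tensor of `(A; u, w) ↦ (Au, Aᵀw)`) and `⟨2,2,2⟩` have a MATRIX leg.
Contract the matrix leg of the `N`-th Kronecker power against a `2^N × 2^N` matrix `X` (rows and
columns indexed by bit strings); what remains is a bilinear form on the two vector legs, i.e. a
block matrix.  Kernel-checked entry formulas:

* `slice_pow_pairTensor` — for `(pairTensor 2)^{⊠N}`: the block with input half-pattern `c`
  (`c i = 0`: a `u`-input, `c i = 1`: a `w`-input at position `i`) and output half-pattern `c + 1`
  is the **partial transpose `τ_c X`** (`(τ_c X)_{o,v}`, `o` = output positions, `v` = input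
  positions); every other block is `0`.  So `C₁^{⊠N}` is the tensor of
  `(X; (v_c)_{c ∈ (ℤ/2)^N}) ↦ (τ_c(X) v_c)_c` — ONE matrix, ALL `2^N` orientations, one vector
  each (level `1`: `(A; u, w) ↦ (Au, Aᵀw)`, "two `⟨2,2,1⟩` glued with OPPOSITE orientation").
* `slice_pow_matMul` — for `⟨2,2,2⟩^{⊠N} = ⟨2^N, 2^N, 2^N⟩`: the block (output column labels `d`,
  input column labels `d'`) is `X = τ_0 X` if `d = d'` and `0` otherwise — ONE matrix, ONE
  orientation, `2^N` vectors ("glued with EQUAL orientation").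
* `kroneckerPow_coupling₁_eq` transports the first formula to `coupling₁` itself (decoders).

Together with the no-untwisting lemma (`ptrans_not_untwistable`: no vector-leg matrices turn a
block `τ_c X`, `c ≠ 0`, into `X`) and the separable no-go (`two_pow_le_of_sepCert`), this is the
normal form behind the exchange exponent: a certificate `⟨B⟩ ⊠ C₁^{⊠N} ⊵ ⟨2,2,2⟩^{⊠N}` with
`B < 2^N` must synthesise untwisted columns out of several differently twisted blocks.

## References

* M. Bläser, *Fast Matrix Multiplication*, Theory of Computing Graduate Surveys 5 (2013), §5
  (the tensor `⟨k,m,n⟩`), Def. 7.2. [Blaser2013]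
* D. Coppersmith, S. Winograd, *Matrix multiplication via arithmetic progressions*,
  J. Symb. Comp. 9 (1990), §6–7. [CoppersmithWinograd1990]
* M. Christandl, P. Vrana, J. Zuiddam, *Universal points in the asymptotic spectrum of tensors*,
  J. AMS 36 (2023), §1.1 (Kronecker powers). [ChristandlVranaZuiddam2023]
-/

noncomputable section

open scoped BigOperators Matrix

set_option linter.dupNamespace false
set_option autoImplicit false

namespace Summit.MatrixMultiplication.MatrixMultiplication.Theorems.OutsiderSandwichTwistSlices

open Literature.Computability.AlgebraicComplexity
  Summit.MatrixMultiplication.MatrixMultiplication.Theorems.OutsiderSandwichCoupling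
  Summit.MatrixMultiplication.MatrixMultiplication.Theorems.OutsiderSandwichBlockNormalForm
  Summit.MatrixMultiplication.MatrixMultiplication.Theorems.OutsiderSandwichTwistGluing

universe u

variable {N : ℕ}

/-! ## 1. `C₁^{⊠N}`: all `2^N` partial transposes of one matrix -/

/-- One coordinate of the `pairTensor 2` power, normalised: the output half-bit is the complement
of the input half-bit `b`, and the matrix index is the `b`-twist of (output position, input
position). -/
theorem pairTensor_two_eq (x y z : Fin 2 × Fin 2) :
    pairTensor 2 x y z =
      if z.1 = y.1 + 1 ∧ x = (if y.1 = 1 then y.2 else z.2, if y.1 = 1 then z.2 else y.2)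
      then 1 else 0 := by
  obtain ⟨x1, x2⟩ := x
  obtain ⟨y1, y2⟩ := y
  obtain ⟨z1, z2⟩ := z
  unfold pairTensor
  refine if_congr ?_ rfl rfl
  revert x1 x2 y1 y2 z1 z2
  decide

/-- **Entry formula of `(pairTensor 2)^{⊠N}`**: entry `1` exactly when the output half-pattern is
the complement of the input half-pattern `c = (y ·).1` and the matrix index is the `c`-twist of
(output positions, input positions). -/
theorem kroneckerPow_pairTensor_eq (a y z : Fin N → Fin 2 × Fin 2) :
    kroneckerPow (pairTensor 2) N a y z =
      if (∀ i, (z i).1 = (y i).1 + 1) ∧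
          a = fun i => (if (y i).1 = 1 then (y i).2 else (z i).2,
                       if (y i).1 = 1 then (z i).2 else (y i).2)
      then 1 else 0 := by
  rw [kroneckerPow_apply]
  by_cases H : (∀ i, (z i).1 = (y i).1 + 1) ∧
      a = fun i => (if (y i).1 = 1 then (y i).2 else (z i).2,
                   if (y i).1 = 1 then (z i).2 else (y i).2)
  · rw [if_pos H]
    refine Finset.prod_eq_one fun i _ => ?_
    rw [pairTensor_two_eq, if_pos]
    exact ⟨H.1 i, congrFun H.2 i⟩
  · rw [if_neg H]
    have hex : ∃ i, ¬ ((z i).1 = (y i).1 + 1 ∧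
        a i = (if (y i).1 = 1 then (y i).2 else (z i).2,
               if (y i).1 = 1 then (z i).2 else (y i).2)) := by
      by_contra hne
      have hall : ∀ i, (z i).1 = (y i).1 + 1 ∧
          a i = (if (y i).1 = 1 then (y i).2 else (z i).2,
                 if (y i).1 = 1 then (z i).2 else (y i).2) :=
        fun i => by by_contra hi; exact hne ⟨i, hi⟩
      exact H ⟨fun i => (hall i).1, funext fun i => (hall i).2⟩
    obtain ⟨i, hi⟩ := hex
    exact Finset.prod_eq_zero (Finset.mem_univ i) (by rw [pairTensor_two_eq, if_neg hi])

/-- **The matrix slices of `C₁^{⊠N}` are all `2^N` partial transposes of one matrix.**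
Contracting the matrix leg of `(pairTensor 2)^{⊠N}` against `X` (entry `X_{r,s}` at the index with
row bits `r` and column bits `s`), the block with input half-pattern `c = (y ·).1` and output
half-pattern `c + 1` is `(τ_c X)_{o,v}` (`o` = output positions, `v` = input positions): the
bilinear map `(X, v) ↦ τ_c(X) v`.  All other blocks vanish. -/
theorem slice_pow_pairTensor (X : Matrix (Idx N) (Idx N) ℂ) (y z : Fin N → Fin 2 × Fin 2) :
    ∑ a : Fin N → Fin 2 × Fin 2, X (fun i => (a i).1) (fun i => (a i).2) *
        kroneckerPow (pairTensor 2) N a y z =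
      if ∀ i, (z i).1 = (y i).1 + 1 then
        ptrans (fun i => (y i).1) X (fun i => (z i).2) (fun i => (y i).2)
      else 0 := by
  by_cases h : ∀ i, (z i).1 = (y i).1 + 1
  · rw [if_pos h, Finset.sum_eq_single (fun i => (if (y i).1 = 1 then (y i).2 else (z i).2,
        if (y i).1 = 1 then (z i).2 else (y i).2))]
    · rw [kroneckerPow_pairTensor_eq, if_pos ⟨h, rfl⟩, mul_one]
      rfl
    · intro a _ ha
      rw [kroneckerPow_pairTensor_eq, if_neg (fun H => ha H.2), mul_zero]
    · intro h'
      exact absurd (Finset.mem_univ _) h'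
  · rw [if_neg h]
    exact Finset.sum_eq_zero fun a _ => by
      rw [kroneckerPow_pairTensor_eq, if_neg (fun H => h H.1), mul_zero]

/-- The diagonal blocks: input half-pattern `c`, output half-pattern `c + 1`, is EXACTLY `τ_c X`. -/
theorem slice_pow_pairTensor_block (X : Matrix (Idx N) (Idx N) ℂ) (c o v : Idx N) :
    ∑ a : Fin N → Fin 2 × Fin 2, X (fun i => (a i).1) (fun i => (a i).2) *
        kroneckerPow (pairTensor 2) N a (fun i => (c i, v i)) (fun i => (c i + 1, o i)) =
      ptrans c X o v := by
  rw [slice_pow_pairTensor, if_pos (fun i => rfl)]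

/-- `C₁^{⊠N}` is `(pairTensor 2)^{⊠N}` along the decoders, so the slice formula applies to
`coupling₁` verbatim after decoding the three legs. -/
theorem kroneckerPow_coupling₁_eq (N : ℕ) (a b c : Fin N → Fin 4) :
    kroneckerPow coupling₁ N a b c =
      kroneckerPow (pairTensor 2) N (fun i => decode (a i)) (fun i => decode (b i))
        (fun i => decode (c i)) := by
  simp only [kroneckerPow_apply, coupling₁_eq_pairTensor]

/-! ## 2. `⟨2,2,2⟩^{⊠N}`: `2^N` untwisted copies of one matrix -/

section MatMul

variable {K : Type u} [CommSemiring K]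

/-- One coordinate of the `⟨2,2,2⟩` power, normalised (`a = (κ,ν)` the form `Z_{κν}`,
`b = (κ,μ)` the matrix variable `X_{κμ}`, `c = (μ,ν)` the vector variable `Y_{μν}`): output and
input share the column label `ν`, and the matrix index is the UNtwisted pair `(κ, μ)`. -/
theorem matMulTensor_two_eq (a b c : Fin 2 × Fin 2) :
    matMulTensor K 2 2 2 a b c = if a.2 = c.2 ∧ b = (a.1, c.1) then 1 else 0 := by
  obtain ⟨a1, a2⟩ := a
  obtain ⟨b1, b2⟩ := b
  obtain ⟨c1, c2⟩ := c
  unfold matMulTensor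
  refine if_congr ?_ rfl rfl
  revert a1 a2 b1 b2 c1 c2
  decide

/-- Entry formula of `⟨2,2,2⟩^{⊠N} = ⟨2^N, 2^N, 2^N⟩`. -/
theorem kroneckerPow_matMul_eq (a b c : Fin N → Fin 2 × Fin 2) :
    kroneckerPow (matMulTensor K 2 2 2) N a b c =
      if (∀ i, (a i).2 = (c i).2) ∧ b = fun i => ((a i).1, (c i).1) then 1 else 0 := by
  rw [kroneckerPow_apply]
  by_cases H : (∀ i, (a i).2 = (c i).2) ∧ b = fun i => ((a i).1, (c i).1)
  · rw [if_pos H]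
    refine Finset.prod_eq_one fun i _ => ?_
    rw [matMulTensor_two_eq, if_pos]
    exact ⟨H.1 i, congrFun H.2 i⟩
  · rw [if_neg H]
    have hex : ∃ i, ¬ ((a i).2 = (c i).2 ∧ b i = ((a i).1, (c i).1)) := by
      by_contra hne
      have hall : ∀ i, (a i).2 = (c i).2 ∧ b i = ((a i).1, (c i).1) :=
        fun i => by by_contra hi; exact hne ⟨i, hi⟩
      exact H ⟨fun i => (hall i).1, funext fun i => (hall i).2⟩
    obtain ⟨i, hi⟩ := hex
    exact Finset.prod_eq_zero (Finset.mem_univ i) (by rw [matMulTensor_two_eq, if_neg hi])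

/-- **The matrix slices of `⟨2,2,2⟩^{⊠N}` are `2^N` UNtwisted copies of one matrix**: contracting
the matrix leg against `X`, the block (output column labels `(a ·).2`, input column labels
`(c ·).2`) is `X_{κ,μ} = (τ_0 X)_{κ,μ}` when the labels agree and `0` otherwise. -/
theorem slice_pow_matMul (X : Matrix (Idx N) (Idx N) K) (a c : Fin N → Fin 2 × Fin 2) :
    ∑ b : Fin N → Fin 2 × Fin 2, X (fun i => (b i).1) (fun i => (b i).2) *
        kroneckerPow (matMulTensor K 2 2 2) N a b c =
      if ∀ i, (a i).2 = (c i).2 then ptrans 0 X (fun i => (a i).1) (fun i => (c i).1) else 0 := by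
  by_cases h : ∀ i, (a i).2 = (c i).2
  · rw [if_pos h, ptrans_zero, Finset.sum_eq_single (fun i => ((a i).1, (c i).1))]
    · rw [kroneckerPow_matMul_eq, if_pos ⟨h, rfl⟩, mul_one]
    · intro b _ hb
      rw [kroneckerPow_matMul_eq, if_neg (fun H => hb H.2), mul_zero]
    · intro h'
      exact absurd (Finset.mem_univ _) h'
  · rw [if_neg h]
    exact Finset.sum_eq_zero fun b _ => by
      rw [kroneckerPow_matMul_eq, if_neg (fun H => h H.1), mul_zero]

/-- The diagonal blocks of `⟨2,2,2⟩^{⊠N}`: equal column labels `d`, block EXACTLY `X`. -/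
theorem slice_pow_matMul_block (X : Matrix (Idx N) (Idx N) K) (d κ μ : Idx N) :
    ∑ b : Fin N → Fin 2 × Fin 2, X (fun i => (b i).1) (fun i => (b i).2) *
        kroneckerPow (matMulTensor K 2 2 2) N (fun i => (κ i, d i)) b (fun i => (μ i, d i)) =
      X κ μ := by
  rw [slice_pow_matMul, if_pos (fun i => rfl), ptrans_zero]

end MatMul

/-! ## 3. The contrast in one line each -/

/-- **All orientations occur in `C₁^{⊠N}`**: for every pattern `c` some block of the matrix
slice is `τ_c X` — in particular, by the no-untwisting lemma, for `c ≠ 0` a block that no pair of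
vector-leg matrices maps back to `X`. -/
theorem exists_block_eq_ptrans (X : Matrix (Idx N) (Idx N) ℂ) (c : Idx N) :
    ∃ y z : Idx N → (Fin N → Fin 2 × Fin 2),
      ∀ o v, ∑ a : Fin N → Fin 2 × Fin 2, X (fun i => (a i).1) (fun i => (a i).2) *
        kroneckerPow (pairTensor 2) N a (y v) (z o) = ptrans c X o v :=
  ⟨fun v i => (c i, v i), fun o i => (c i + 1, o i), fun o v => slice_pow_pairTensor_block X c o v⟩

/-- **Only the trivial orientation occurs in `⟨2,2,2⟩^{⊠N}`**: every block of its matrix slice is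
`X` itself or `0`. -/
theorem block_matMul_eq_or_zero {K : Type u} [CommSemiring K] (X : Matrix (Idx N) (Idx N) K)
    (a c : Fin N → Fin 2 × Fin 2) :
    (∑ b : Fin N → Fin 2 × Fin 2, X (fun i => (b i).1) (fun i => (b i).2) *
        kroneckerPow (matMulTensor K 2 2 2) N a b c = X (fun i => (a i).1) (fun i => (c i).1)) ∨
    (∑ b : Fin N → Fin 2 × Fin 2, X (fun i => (b i).1) (fun i => (b i).2) *
        kroneckerPow (matMulTensor K 2 2 2) N a b c = 0) := by
  rw [slice_pow_matMul]
  by_cases h : ∀ i, (a i).2 = (c i).2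
  · left; rw [if_pos h, ptrans_zero]
  · right; rw [if_neg h]

end Summit.MatrixMultiplication.MatrixMultiplication.Theorems.OutsiderSandwichTwistSlices
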